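import Mathlib
import HarnessLib
import Summits.HubbardSuperconductivity.HubbardSuperconductivity.Theorems.KLProgrammeKLRegimeSectorMultiplierOverlapWtFlowDeep
import Summits.HubbardSuperconductivity.HubbardSuperconductivity.Theorems.KLProgrammeKLRegimeEngineTowerModelDefsRate

/-!
# K3 ENGINE child (stmt-HubbardSuperconductivity-20437), stub (b), the LEVELS package (ℓ): the weighted overlap COLUMN constant `cc`
# (`hcol′` of `klWtPinnedSumAt_klTowerIncr_le`: fixed FAT leg, sum over ALL thin legs) on the flow frame `K_n`, deep window, any rate, tower indexing

Cell `gate-hubbard-kl`, seat p3 (g11); completes «W2» (`…SectorMultiplierOverlapWtFlowDeep`, p585156) for E1's blocked tower (E1-LEVELS-BLUEPRINT-g8 §2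
CONVENTION: output family `F_{dk}`, fat partner `F̃_{dk−1}` — «`cr, cc` = the row/col sums of `E(F′)·S(Ft)`, O(1) iff `F′` is not finer than `Ft`»).
p585156 exports the row sums (`cr`, fixed thin leg) and the PER-SECTOR-PAIR column sums; the door's `hcol′` is the FULL column sum over the thin legs, which
costs the fine-side overlap count `27·2^{J′−k}` (`card_overlap_klAniso_bgmFat_fine_le` via `overlapWt_colSum_klAniso_bgmFat_le`, p567340) — `54` at E1's
convention `J′ = k + 1 = dk`.  This file carries that count to the engine constants:

* `overlapWt_colSum_le_of_nbWindow` — kernel level: the full weighted column sums `≤ 27·2^{J′−k}·(3T_J/(βL²))` from a weighted neighbouring bound on the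
  window `[n₀, J′]` (twin of `overlapWt_jump_sums_le_of_nbWindow`);
* `charSumWt_nbWindow_klEng_flow_deep (d′)` — the weighted neighbouring bounds themselves on the flow frame `K_n`, weight scale `J′`, all levels
  `k + 1 ≤ m ≤ J′`, deep window `4ⁿ·U ≤ 4^{2(k+1)+d′}` (the datum block of p585156's proof, exported once);
* **`overlapWt_colSum_klEng_flow_deep (d′)`** — `Σ_{X″} ‖(E(F_{J′})S(F̃_k))(X″,X′)‖·w_{J′} ≤ 81·2^{J′−k}·C_J·M/β` under p585156's binders;
* `overlapWt_colSum_klEng_flow_deep_rate (d′)` — the same with the weight `klScaleWt … jw`, any `jw ≥ J′`;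
* **`overlapWt_towerBlockCol_klEng_flow_deep (d d′)`** — fat `d·k − 1`, thin `J′ ≥ d·k`, weight `jw ≥ J′`: E1's `hcol′` with
  `cc := 81·2^{J′−(dk−1)}·C_J·M/β` (`= 162·C_J·M/β` at `J′ = dk`).

Everything is proved; no definitions; nothing about the model is asserted. [cite: BenfattoGiulianiMastropietro2006, §2.7 (2.71a), §2.8 (2.77), (2.82)–(2.83)]
-/

noncomputable section

namespace Summit.HubbardSuperconductivity.HubbardSuperconductivity.Theorems.TorusFourierL2

set_option linter.dupNamespace false -- summit = problem name (single-conjunct summit), D-0017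

open Set Finset Literature.MathematicalPhysics.QuantumLattice Literature.MathematicalPhysics.QuantumLattice.BandSectorCounting
open Literature.MathematicalPhysics.QuantumLattice.FermiRG Literature.Probability.LatticeModels Literature.Analysis.SpecialFunctions
open Summit.HubbardSuperconductivity.HubbardSuperconductivity.Theorems.DispersionFlow
open Summit.HubbardSuperconductivity.HubbardSuperconductivity.Theorems.KLRegimeSplit
open Summit.HubbardSuperconductivity.HubbardSuperconductivity.Theorems.KLProgrammeLegKernels
open Summit.HubbardSuperconductivity.HubbardSuperconductivity.Theorems.PerturbedFermiCurve
open scoped Real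

open Classical

section Kernel

variable {L M : ℕ} [NeZero L] [NeZero M]

/-- **The full weighted COLUMN sums of `E(F_{J′})·S(F̃_k)` from a weighted neighbouring bound on the window `[n₀, J′]`** (`n₀ ≤ k + 1 ≤ J′`,
weight scale `J′`): `Σ_{X″} ‖(E S)(X″, X′)‖·w_{J′}{pos X″, pos X′} ≤ 27·2^{J′−k}·(3T_J/(βL²))`, `T_J = T + 729(2ML²)⁻¹T²`.
[cite: BenfattoGiulianiMastropietro2006, §2.7 (2.71a), §2.8 (2.77)] -/
theorem overlapWt_colSum_le_of_nbWindow {β : ℝ} (hβ : 0 < β) (μ : ℝ) (K : TrigPolyC4v) {n₀ : ℕ} {T : ℝ} (hT0 : 0 ≤ T)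
    {J' : ℕ}
    (hT : ∀ n : ℕ, n₀ ≤ n → n ≤ J' → ∀ (ω : Fin (sectorCount n)) (a' : Fin (sectorCount (n - 1))),
      ∑ z : TorusSite 1 (2 * M) × TorusSite 2 L,
        (1 + klScale klE0 J' * β / (2 * M) * |(((z.1 0).valMinAbs : ℤ) : ℝ)| + klScale klE0 J' * |(((z.2 0).valMinAbs : ℤ) : ℝ)| +
            klScale klE0 J' * |(((z.2 1).valMinAbs : ℤ) : ℝ)|) *
        ‖∑ q : TorusSite 1 (2 * M) × TorusSite 2 L, (torusChar q.1 z.1 * torusChar q.2 z.2) •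
          (klAnisoFamily L M β μ K klE0 n ω (⟨(q.1 0).val, ZMod.val_lt (q.1 0)⟩, q.2) *
            klAnisoFamily L M β μ K klE0 (n - 1) a' (⟨(q.1 0).val, ZMod.val_lt (q.1 0)⟩, q.2))‖ ≤ T)
    {k : ℕ} (hn₀k : n₀ ≤ k + 1) (hJ : k + 1 ≤ J') (X' : SpaceTimeIdx L M × SectorLeg (sectorCount k)) :
    ∑ X'' : SpaceTimeIdx L M × SectorLeg (sectorCount J'),
      ‖(sectorAnalysisMatrix L M β (klAnisoFamily L M β μ K klE0 J') *
        sectorSubMatrix L M β (bgmFatMultiplier L M klE0 β (nambuXiCT L μ K) k)) X'' X'‖ *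
        EngineV8.klScaleWt L M β J' {EngineV8.latticeLegPos (2 * (2 * M)) X'', EngineV8.latticeLegPos (2 * (2 * M)) X'} ≤
      (27 * 2 ^ (J' - k) : ℕ) * (3 * (T + 729 * ((((2 * M : ℕ) : ℝ) ^ 1 * (L : ℝ) ^ 2)⁻¹ * T ^ 2)) / (β * (L : ℝ) ^ 2)) := by
  have he : (0 : ℝ) < klE0 := by norm_num [klE0]
  have hΛ : 0 ≤ klScale klE0 J' := (klth_klScale_pos J').le
  have hM : (0 : ℝ) < M := Nat.cast_pos.2 (Nat.pos_of_ne_zero (NeZero.ne M))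
  have ha : 0 ≤ klScale klE0 J' * β / (2 * M) := by positivity
  have hTJ0 : 0 ≤ T + 729 * ((((2 * M : ℕ) : ℝ) ^ 1 * (L : ℝ) ^ 2)⁻¹ * T ^ 2) := by
    have h1 : (0 : ℝ) ≤ ((2 * M : ℕ) : ℝ) := Nat.cast_nonneg _
    have h2 : (0 : ℝ) ≤ L := Nat.cast_nonneg _
    positivity
  have hpair : ∀ (ω₁ : Fin (sectorCount J')) (a' : Fin (sectorCount k)), ∑ z : TorusSite 1 (2 * M) × TorusSite 2 L,
      (1 + klScale klE0 J' * β / (2 * M) * |(((z.1 0).valMinAbs : ℤ) : ℝ)| + klScale klE0 J' * |(((z.2 0).valMinAbs : ℤ) : ℝ)| +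
          klScale klE0 J' * |(((z.2 1).valMinAbs : ℤ) : ℝ)|) *
      ‖∑ q : TorusSite 1 (2 * M) × TorusSite 2 L, (torusChar q.1 z.1 * torusChar q.2 z.2) •
        (klAnisoFamily L M β μ K klE0 J' ω₁ (⟨(q.1 0).val, ZMod.val_lt (q.1 0)⟩, q.2) *
          klAnisoFamily L M β μ K klE0 k a' (⟨(q.1 0).val, ZMod.val_lt (q.1 0)⟩, q.2))‖ ≤
        T + 729 * ((((2 * M : ℕ) : ℝ) ^ 1 * (L : ℝ) ^ 2)⁻¹ * T ^ 2) :=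
    fun ω₁ a' => charSumWt_klAnisoPair_le_of_nbWindow β μ K ha hΛ hT0 hT hn₀k hJ le_rfl ω₁ a'
  exact overlapWt_colSum_klAniso_bgmFat_le he hβ μ K hJ hTJ0 hpair X'

end Kernel

/-- **The weighted neighbouring character-sum bounds on the flow frame `K_n`, weight scale `J′`, all levels `k + 1 ≤ m ≤ J′`, deep window**
(the datum block behind p585156, exported): `≤ C_T·M·L²`. [cite: BenfattoGiulianiMastropietro2006, §2.8 (2.82)–(2.83)] -/
theorem charSumWt_nbWindow_klEng_flow_deep (dd : ℕ) :
    ∃ CT : ℝ, 0 < CT ∧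
      ∀ (G : GeoConsts) (P : SplitConsts) (R : RenConsts) (Q : EngConsts) (cc : ℝ), R.WF2 → 0 < cc → cc ≤ EngineV8.klEngC₃6 P R →
      ∀ μ ∈ klWindowC, ∀ U : ℝ, 0 < U → U ≤ min (EngineV8.klEngU₀3 P R cc) (1 / (R.Gfr 3 + 1)) →
      ∀ β : ℝ, klBetaMin ≤ β → β ≤ Real.exp (cc / U ^ 2) →
      ∀ (L M : ℕ) [NeZero L] [NeZero M], EngineV8.klEngL₃ β U ≤ L → EngineV8.klEngM₃ β U L ≤ M →
      ∀ n : ℕ, 1 ≤ n → n ≤ nScales β + 1 →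
        HistP klPredsV17F2 L M G P Q R β U μ 0 n → FrameOK R U (nScales β) μ (klFlowFrameU L M β U μ n) →
        ∀ k J' : ℕ, k + 1 ≤ J' → J' ≤ n → (4 : ℝ) ^ n * U ≤ (4 : ℝ) ^ (2 * (k + 1) + dd) →
        ∀ m : ℕ, k + 1 ≤ m → m ≤ J' → ∀ (ω : Fin (sectorCount m)) (a' : Fin (sectorCount (m - 1))),
          ∑ z : TorusSite 1 (2 * M) × TorusSite 2 L,
            (1 + klScale klE0 J' * β / (2 * M) * |(((z.1 0).valMinAbs : ℤ) : ℝ)| + klScale klE0 J' * |(((z.2 0).valMinAbs : ℤ) : ℝ)| +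
                klScale klE0 J' * |(((z.2 1).valMinAbs : ℤ) : ℝ)|) *
            ‖∑ q : TorusSite 1 (2 * M) × TorusSite 2 L, (torusChar q.1 z.1 * torusChar q.2 z.2) •
              (klAnisoFamily L M β μ (klFlowFrameU L M β U μ n) klE0 m ω (⟨(q.1 0).val, ZMod.val_lt (q.1 0)⟩, q.2) *
                klAnisoFamily L M β μ (klFlowFrameU L M β U μ n) klE0 (m - 1) a' (⟨(q.1 0).val, ZMod.val_lt (q.1 0)⟩, q.2))‖ ≤
            CT * M * (L : ℝ) ^ 2 := by
  have ha : (-4 : ℝ) < -(6 / 5) := by norm_num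
  have hab : (-(6 / 5) : ℝ) ≤ -(1 / 10) := by norm_num
  have hb : (-(1 / 10) : ℝ) < 0 := by norm_num
  obtain ⟨CT, hCT, h⟩ := charSumWt_klAnisoPair_nb_of_thresholds ha hab hb ((4 : ℝ) ^ dd / 3072)
  refine ⟨CT, hCT, ?_⟩
  intro G P R Q cc hR2 hcc hcc6 μ hμ U hU hUle β hβmin hβc L M _ _ hL3 hM3 n hn1 hnN hhist hfr k J' hJ hJn hnd
  have hRj : ∀ j, 0 ≤ R.Gfr j := EngineV8.gfr_nonneg_of_wf2 hR2
  have hβ0 : 0 < β := pos_of_klBetaMin_le hβmin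
  have hM0 : (0 : ℝ) < M := Nat.cast_pos.2 (Nat.pos_of_ne_zero (NeZero.ne M))
  have hcle := (hcc6.trans (EngineV8.klEngC₃6_le_klEngC₃3 P R)).trans (EngineV8.klEngC₃3_le_symbolC₃ ha hab hb P hRj)
  have hU3 := (hUle.trans (min_le_left _ _)).trans (EngineV8.klEngU₀3_le_symbolU₀ ha hab hb P hRj cc)
  have hUG : U ≤ 1 / (R.Gfr 3 + 1) := hUle.trans (min_le_right _ _)
  have hLβ : β ^ 2 ≤ (L : ℝ) := EngineV8.sq_le_of_klEngL₃_le hL3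
  have hMβ : β ≤ (M : ℝ) := EngineV8.le_of_klEngM₃_le hβmin hL3 hM3
  set K : TrigPolyC4v := klFlowFrameU L M β U μ n with hKdef
  obtain ⟨N, rfl⟩ : ∃ N, n = N + 1 := ⟨n - 1, by omega⟩
  have hh := (histP_klPredsV17F2_iff L M G P Q R β U μ 0 (N + 1)).1 hhist
  have hJets : ∀ m ≤ N, FlowPieceJetsAt L M β U μ R m := fun m hm => (hh m (Nat.lt_succ_of_le hm)).2.1.2.1
  have hGeo : FlowGeometryAt L M β U μ N := (hh N (Nat.lt_succ_self N)).2.1.2.2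
  have hK1 : FrameOK R U N μ K := frameOK_klFlowFrameU_succ hJets hGeo
  have hA3 : ∀ p : Momentum, ‖iteratedFDeriv ℝ 3 (frameShift K) p‖ ≤ R.Gfr 3 * U ^ 2 * ((4 : ℝ) ^ (N + 1) / 3) :=
    (frameShift_high_sizes_of_frameOK hRj hK1).1
  have hGU : R.Gfr 3 * U ≤ 1 := by
    have hG3 := hRj 3
    calc R.Gfr 3 * U ≤ R.Gfr 3 * (1 / (R.Gfr 3 + 1)) := mul_le_mul_of_nonneg_left hUG hG3
      _ = R.Gfr 3 / (R.Gfr 3 + 1) := by ring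
      _ ≤ 1 := by rw [div_le_one (by positivity)]; linarith only [hG3]
  have hdat : ∀ m : ℕ, k + 1 ≤ m → R.Gfr 3 * U ^ 2 * ((4 : ℝ) ^ (N + 1) / 3) * klScale klE0 m ^ 2 ≤ (4 : ℝ) ^ dd / 3072 :=
    fun m hm => frameDatumAt_le_of_pow_window hU.le hGU hm hnd
  intro m hkm hmJ ω a'
  have hbd := h R hRj cc U hcc hcle hU hU3 β hβmin hβc μ hμ K hfr (R.Gfr 3 * U ^ 2 * ((4 : ℝ) ^ (N + 1) / 3)) hA3 L M hLβ hMβ m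
    (by omega) (by omega) (hdat m hkm) ω a'
  refine le_trans (sum_le_sum fun z _ => mul_le_mul_of_nonneg_right ?_ (norm_nonneg _)) hbd
  have hΛle : klScale klE0 J' ≤ klScale klE0 m := EngineV8.klScale_le_klScale (by norm_num [klE0]) hmJ
  have h0 : 0 ≤ |(((z.1 0).valMinAbs : ℤ) : ℝ)| := abs_nonneg _
  have h1 : 0 ≤ |(((z.2 0).valMinAbs : ℤ) : ℝ)| := abs_nonneg _
  have h2 : 0 ≤ |(((z.2 1).valMinAbs : ℤ) : ℝ)| := abs_nonneg _
  have hβM : 0 ≤ β / (2 * M) := by positivity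
  have hΛ0 : 0 ≤ klScale klE0 J' := (klth_klScale_pos J').le
  have ht : klScale klE0 J' * β / (2 * M) ≤ klScale klE0 m * β / (2 * M) := by
    rw [mul_div_assoc, mul_div_assoc]; exact mul_le_mul_of_nonneg_right hΛle hβM
  gcongr

/-- **The full weighted COLUMN sums `cc` of `E(F_{J′})·S(F̃_k)` on the flow frame `K_n`, deep window** (see the module docstring):
`≤ 81·2^{J′−k}·C_J·M/β`. [cite: BenfattoGiulianiMastropietro2006, §2.7 (2.71a), §2.8 (2.77), (2.82)–(2.83)] -/
theorem overlapWt_colSum_klEng_flow_deep (dd : ℕ) :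
    ∃ CJ : ℝ, 0 < CJ ∧
      ∀ (G : GeoConsts) (P : SplitConsts) (R : RenConsts) (Q : EngConsts) (cc : ℝ), R.WF2 → 0 < cc → cc ≤ EngineV8.klEngC₃6 P R →
      ∀ μ ∈ klWindowC, ∀ U : ℝ, 0 < U → U ≤ min (EngineV8.klEngU₀3 P R cc) (1 / (R.Gfr 3 + 1)) →
      ∀ β : ℝ, klBetaMin ≤ β → β ≤ Real.exp (cc / U ^ 2) →
      ∀ (L M : ℕ) [NeZero L] [NeZero M], EngineV8.klEngL₃ β U ≤ L → EngineV8.klEngM₃ β U L ≤ M →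
      ∀ n : ℕ, 1 ≤ n → n ≤ nScales β + 1 →
        HistP klPredsV17F2 L M G P Q R β U μ 0 n → FrameOK R U (nScales β) μ (klFlowFrameU L M β U μ n) →
        ∀ k J' : ℕ, k + 1 ≤ J' → J' ≤ n → (4 : ℝ) ^ n * U ≤ (4 : ℝ) ^ (2 * (k + 1) + dd) →
        ∀ X' : SpaceTimeIdx L M × SectorLeg (sectorCount k),
          ∑ X'' : SpaceTimeIdx L M × SectorLeg (sectorCount J'),
            ‖(sectorAnalysisMatrix L M β (klAnisoFamily L M β μ (klFlowFrameU L M β U μ n) klE0 J') *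
              sectorSubMatrix L M β (bgmFatMultiplier L M klE0 β (nambuXiCT L μ (klFlowFrameU L M β U μ n)) k)) X'' X'‖ *
              EngineV8.klScaleWt L M β J' {EngineV8.latticeLegPos (2 * (2 * M)) X'', EngineV8.latticeLegPos (2 * (2 * M)) X'} ≤
            81 * (2 : ℝ) ^ (J' - k) * CJ * M / β := by
  obtain ⟨CT, hCT, h⟩ := charSumWt_nbWindow_klEng_flow_deep dd
  refine ⟨CT + 729 * CT ^ 2 / 2, by positivity, ?_⟩
  intro G P R Q cc hR2 hcc hcc6 μ hμ U hU hUle β hβmin hβc L M _ _ hL3 hM3 n hn1 hnN hhist hfr k J' hJ hJn hnd X'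
  have hβ0 : 0 < β := pos_of_klBetaMin_le hβmin
  have hL0 : (0 : ℝ) < L := Nat.cast_pos.2 (Nat.pos_of_ne_zero (NeZero.ne L))
  have hM0 : (0 : ℝ) < M := Nat.cast_pos.2 (Nat.pos_of_ne_zero (NeZero.ne M))
  have hT := h G P R Q cc hR2 hcc hcc6 μ hμ U hU hUle β hβmin hβc L M hL3 hM3 n hn1 hnN hhist hfr k J' hJ hJn hnd
  have hT0 : 0 ≤ CT * M * (L : ℝ) ^ 2 := by positivity
  have hcol := overlapWt_colSum_le_of_nbWindow (L := L) (M := M) hβ0 μ (klFlowFrameU L M β U μ n) (n₀ := k + 1) hT0 hT le_rfl hJ X'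
  have eTJ : CT * M * (L : ℝ) ^ 2 + 729 * ((((2 * M : ℕ) : ℝ) ^ 1 * (L : ℝ) ^ 2)⁻¹ * (CT * M * (L : ℝ) ^ 2) ^ 2) =
      (CT + 729 * CT ^ 2 / 2) * M * (L : ℝ) ^ 2 := by
    push_cast
    field_simp
  have e81 : ((27 * 2 ^ (J' - k) : ℕ) : ℝ) * (3 * ((CT + 729 * CT ^ 2 / 2) * M * (L : ℝ) ^ 2) / (β * (L : ℝ) ^ 2)) =
      81 * (2 : ℝ) ^ (J' - k) * (CT + 729 * CT ^ 2 / 2) * M / β := by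
    push_cast
    field_simp
    ring
  rw [eTJ, e81] at hcol
  exact hcol

/-- **The full weighted column sums at any weaker rate `jw ≥ J′`.** [cite: BenfattoGiulianiMastropietro2006, §2.7 (2.71a), §2.8 (2.77)] -/
theorem overlapWt_colSum_klEng_flow_deep_rate (dd : ℕ) :
    ∃ CJ : ℝ, 0 < CJ ∧
      ∀ (G : GeoConsts) (P : SplitConsts) (R : RenConsts) (Q : EngConsts) (cc : ℝ), R.WF2 → 0 < cc → cc ≤ EngineV8.klEngC₃6 P R →
      ∀ μ ∈ klWindowC, ∀ U : ℝ, 0 < U → U ≤ min (EngineV8.klEngU₀3 P R cc) (1 / (R.Gfr 3 + 1)) →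
      ∀ β : ℝ, klBetaMin ≤ β → β ≤ Real.exp (cc / U ^ 2) →
      ∀ (L M : ℕ) [NeZero L] [NeZero M], EngineV8.klEngL₃ β U ≤ L → EngineV8.klEngM₃ β U L ≤ M →
      ∀ n : ℕ, 1 ≤ n → n ≤ nScales β + 1 →
        HistP klPredsV17F2 L M G P Q R β U μ 0 n → FrameOK R U (nScales β) μ (klFlowFrameU L M β U μ n) →
        ∀ k J' : ℕ, k + 1 ≤ J' → J' ≤ n → (4 : ℝ) ^ n * U ≤ (4 : ℝ) ^ (2 * (k + 1) + dd) → ∀ jw : ℕ, J' ≤ jw →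
        ∀ X' : SpaceTimeIdx L M × SectorLeg (sectorCount k),
          ∑ X'' : SpaceTimeIdx L M × SectorLeg (sectorCount J'),
            ‖(sectorAnalysisMatrix L M β (klAnisoFamily L M β μ (klFlowFrameU L M β U μ n) klE0 J') *
              sectorSubMatrix L M β (bgmFatMultiplier L M klE0 β (nambuXiCT L μ (klFlowFrameU L M β U μ n)) k)) X'' X'‖ *
              EngineV8.klScaleWt L M β jw {EngineV8.latticeLegPos (2 * (2 * M)) X'', EngineV8.latticeLegPos (2 * (2 * M)) X'} ≤
            81 * (2 : ℝ) ^ (J' - k) * CJ * M / β := by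
  obtain ⟨CJ, hCJ, h⟩ := overlapWt_colSum_klEng_flow_deep dd
  refine ⟨CJ, hCJ, ?_⟩
  intro G P R Q cc hR2 hcc hcc6 μ hμ U hU hUle β hβmin hβc L M _ _ hL3 hM3 n hn1 hnN hhist hfr k J' hJ hJn hnd jw hjw X'
  have hcol := h G P R Q cc hR2 hcc hcc6 μ hμ U hU hUle β hβmin hβc L M hL3 hM3 n hn1 hnN hhist hfr k J' hJ hJn hnd X'
  exact (Finset.sum_le_sum fun X'' _ => mul_le_mul_of_nonneg_left (EngineV8.klScaleWt_le_of_le β hjw _) (norm_nonneg _)).trans hcol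

/-- **The full weighted column sums in the tower's indexing** (fat `d·k − 1`, thin `J′ ≥ d·k`, weight `jw ≥ J′`): E1's `hcol′` with
`cc := 81·2^{J′−(dk−1)}·C_J·M/β`. [cite: BenfattoGiulianiMastropietro2006, §2.7 (2.71a), §2.8 (2.77)] -/
theorem overlapWt_towerBlockCol_klEng_flow_deep (d dd : ℕ) :
    ∃ CJ : ℝ, 0 < CJ ∧
      ∀ (G : GeoConsts) (P : SplitConsts) (R : RenConsts) (Q : EngConsts) (cc : ℝ), R.WF2 → 0 < cc → cc ≤ EngineV8.klEngC₃6 P R →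
      ∀ μ ∈ klWindowC, ∀ U : ℝ, 0 < U → U ≤ min (EngineV8.klEngU₀3 P R cc) (1 / (R.Gfr 3 + 1)) →
      ∀ β : ℝ, klBetaMin ≤ β → β ≤ Real.exp (cc / U ^ 2) →
      ∀ (L M : ℕ) [NeZero L] [NeZero M], EngineV8.klEngL₃ β U ≤ L → EngineV8.klEngM₃ β U L ≤ M →
      ∀ n : ℕ, 1 ≤ n → n ≤ nScales β + 1 →
        HistP klPredsV17F2 L M G P Q R β U μ 0 n → FrameOK R U (nScales β) μ (klFlowFrameU L M β U μ n) →
        ∀ k : ℕ, 1 ≤ d * k → ∀ J' : ℕ, d * k ≤ J' → J' ≤ n → (4 : ℝ) ^ n * U ≤ (4 : ℝ) ^ (2 * (d * k) + dd) → ∀ jw : ℕ, J' ≤ jw →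
        ∀ X' : SpaceTimeIdx L M × SectorLeg (sectorCount (d * k - 1)),
          ∑ X'' : SpaceTimeIdx L M × SectorLeg (sectorCount J'),
            ‖(sectorAnalysisMatrix L M β (klAnisoFamily L M β μ (klFlowFrameU L M β U μ n) klE0 J') *
              sectorSubMatrix L M β (bgmFatMultiplier L M klE0 β (nambuXiCT L μ (klFlowFrameU L M β U μ n)) (d * k - 1))) X'' X'‖ *
              EngineV8.klScaleWt L M β jw {EngineV8.latticeLegPos (2 * (2 * M)) X'', EngineV8.latticeLegPos (2 * (2 * M)) X'} ≤
            81 * (2 : ℝ) ^ (J' - (d * k - 1)) * CJ * M / β := by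
  obtain ⟨CJ, hCJ, h⟩ := overlapWt_colSum_klEng_flow_deep_rate dd
  refine ⟨CJ, hCJ, ?_⟩
  intro G P R Q cc hR2 hcc hcc6 μ hμ U hU hUle β hβmin hβc L M _ _ hL3 hM3 n hn1 hnN hhist hfr k hdk J' hJ' hJn hnd jw hjw X'
  have e1 : d * k - 1 + 1 = d * k := by omega
  exact h G P R Q cc hR2 hcc hcc6 μ hμ U hU hUle β hβmin hβc L M hL3 hM3 n hn1 hnN hhist hfr (d * k - 1) J' (by omega) hJn
    (by rw [e1]; exact hnd) jw hjw X'

end Summit.HubbardSuperconductivity.HubbardSuperconductivity.Theorems.TorusFourierL2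

end
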